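import Literature.MathematicalPhysics.StatisticalMechanics.BarlowRings

/-!
# The first shell and its 4-regular link of a Barlow stacking on the layer-spacing window

Stub `stub_barlowWindowLink` of the line `frustration-free-census-germ` for the crux
`PricedLinkCensus.TruncatedCensusGap` (item stmt-AtomisticToContinuum-14230), registered by
`ledger skeleton check` on the skeleton `Cruxes/TruncatedCensusGap/Lines/frustration_free_census_germ.lean`.
The statement below is the registered signature VERBATIM (self-contained over tree declarations).

Window twin (`0.81a ≤ c ≤ 0.85a`) of `BarlowCoordination.ncard_touching_eq_twelve` and `BarlowRings.ncard_commonTouching_eq_four` (ideal case `c² = 2a²/3`).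

## Method

With `P = i − i'`, `Q = j − j'`, `K = k − k'`, `Λ = L(k) − L(k')`,
`BarlowStacking.dist_barlowPos_sq` gives `12 · dist² = a² · (3(2P+Q+Λ)² + (3Q+Λ)²) + 12 K² c²`
for a FREE layer spacing `c` (`twelve_mul_dist_sq_window`). On the window
`0.81 a ≤ c ≤ 0.85 a`, `dist < 7a/5` forces `|K| ≤ 1`; for `K = 0` the in-layer form is `0` or
`12` (`twelve_le_inLayer`), for `|K| = 1` the adjacent form is `4`
(`adjLayer_eq_four_or_sixteen_le`), so the near points are exactly the twelve offsets of
`BarlowCoordination.touching_eq_union` (`near_iff_offsets`), at distance `a` (in layer) or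
`√(a²/3 + c²)` (adjacent layers). The common near points are then counted in relative
coordinates by `BarlowRings.card_filter_linkAdj`.
-/

noncomputable section

namespace Summit.AtomisticToContinuum.Crystallization.Theorems.PricedLinkCensusTruncatedCensusGap

open scoped BigOperators
open Literature.MathematicalPhysics.StatisticalMechanics

/-! ## The distance form with a free layer spacing -/

/-- **`12 · dist² = a² · (3(2P+Q+Λ)² + (3Q+Λ)²) + 12 K² c²`** for an arbitrary layer spacing
`c`, with `P = i − i'`, `Q = j − j'`, `K = k − k'`, `Λ = L(k) − L(k')`. [folklore] -/
theorem twelve_mul_dist_sq_window (a c : ℝ) (s : ℤ → ℤ) (k i j k' i' j' : ℤ) :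
    12 * dist (barlowPos a c s k i j) (barlowPos a c s k' i' j') ^ 2 =
      a ^ 2 * ((3 * (2 * (i - i') + (j - j') + (haggLabel s k - haggLabel s k')) ^ 2 +
        (3 * (j - j') + (haggLabel s k - haggLabel s k')) ^ 2 : ℤ) : ℝ) +
      12 * (((k - k') ^ 2 : ℤ) : ℝ) * c ^ 2 := by
  rw [dist_barlowPos_sq]
  have h3 : (√3 : ℝ) ^ 2 = 3 := Real.sq_sqrt (by norm_num)
  push_cast
  linear_combination
    (3 * a ^ 2 * ((j : ℝ) - j' + ((haggLabel s k : ℝ) - haggLabel s k') / 3) ^ 2) * h3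

section Window

variable {a c : ℝ} {s : ℤ → ℤ}

/-- `((m - m)² : ℤ)` cast to `ℝ` is `0`. [folklore] -/
private theorem cast_sub_self_sq (m : ℤ) : (((m - m) ^ 2 : ℤ) : ℝ) = 0 := by simp

/-- **Squared distances of the twelve offsets** (free layer spacing `c`): an in-layer offset is at
squared distance `a²`, an adjacent-layer offset at squared distance `a²/3 + c²`. [folklore] -/
theorem sq_dist_of_offsets (hs : IsHaggSeq s) {k i j k' i' j' : ℤ}
    (hN : (k' = k ∧ (i - i', j - j') ∈ sixOffsets) ∨
      (k' = k + 1 ∧ (i - i', j - j') ∈ threeOffsets (-s k)) ∨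
      (k' = k - 1 ∧ (i - i', j - j') ∈ threeOffsets (s (k - 1)))) :
    dist (barlowPos a c s k i j) (barlowPos a c s k' i' j') ^ 2 = a ^ 2 ∨
      dist (barlowPos a c s k i j) (barlowPos a c s k' i' j') ^ 2 = a ^ 2 / 3 + c ^ 2 := by
  have h12 := twelve_mul_dist_sq_window a c s k i j k' i' j'
  have hsp : -s k = 1 ∨ -s k = -1 := by rcases hs k with h1 | h1 <;> omega
  have hsm : s (k - 1) = 1 ∨ s (k - 1) = -1 := hs (k - 1)
  rcases hN with ⟨rfl, hm⟩ | ⟨rfl, hm⟩ | ⟨rfl, hm⟩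
  · left
    rw [sub_self, cast_sub_self_sq] at h12
    have hF := mem_sixOffsets_iff.1 hm
    have hF' : ((3 * (2 * (i - i') + (j - j') + 0) ^ 2 + (3 * (j - j') + 0) ^ 2 : ℤ) : ℝ) =
        12 := by simp only [add_zero]; exact_mod_cast hF
    rw [hF'] at h12
    nlinarith
  · right
    rw [haggLabel_sub_haggLabel_succ] at h12
    have hF := (mem_threeOffsets_iff hsp).1 hm
    have e1 : (((k - (k + 1)) ^ 2 : ℤ) : ℝ) = 1 := by push_cast; ring
    have hF' : ((3 * (2 * (i - i') + (j - j') + -s k) ^ 2 +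
        (3 * (j - j') + -s k) ^ 2 : ℤ) : ℝ) = 4 := by exact_mod_cast hF
    rw [e1, hF'] at h12
    nlinarith
  · right
    rw [haggLabel_sub_haggLabel_pred] at h12
    have hF := (mem_threeOffsets_iff hsm).1 hm
    have e1 : (((k - (k - 1)) ^ 2 : ℤ) : ℝ) = 1 := by push_cast; ring
    have hF' : ((3 * (2 * (i - i') + (j - j') + s (k - 1)) ^ 2 +
        (3 * (j - j') + s (k - 1)) ^ 2 : ℤ) : ℝ) = 4 := by exact_mod_cast hF
    rw [e1, hF'] at h12
    nlinarith

/-- **The near points are the twelve offsets.** On the window `0.81 a ≤ c ≤ 0.85 a`, a point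
`barlowPos a c s k' i' j'` of the stacking different from `barlowPos a c s k i j` is closer than
`7a/5` to it iff it is one of the six in-layer neighbours, one of three points of layer `k + 1`
(offsets `threeOffsets (−s k)`) or one of three points of layer `k − 1`
(offsets `threeOffsets (s (k−1))`). [cite: HalesDSP2012, §1.3] -/
theorem near_iff_offsets (hs : IsHaggSeq s) (ha : 0 < a) (hc1 : 81 / 100 * a ≤ c)
    (hc2 : c ≤ 17 / 20 * a) (k i j k' i' j' : ℤ) :
    (barlowPos a c s k' i' j' ≠ barlowPos a c s k i j ∧
        dist (barlowPos a c s k' i' j') (barlowPos a c s k i j) < 7 / 5 * a) ↔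
      (k' = k ∧ (i - i', j - j') ∈ sixOffsets) ∨
      (k' = k + 1 ∧ (i - i', j - j') ∈ threeOffsets (-s k)) ∨
      (k' = k - 1 ∧ (i - i', j - j') ∈ threeOffsets (s (k - 1))) := by
  rw [dist_comm]
  have h12 := twelve_mul_dist_sq_window a c s k i j k' i' j'
  have hd0 : 0 ≤ dist (barlowPos a c s k i j) (barlowPos a c s k' i' j') := dist_nonneg
  have ha2 : 0 < a ^ 2 := by positivity
  have hc0 : 0 ≤ 81 / 100 * a := by positivity
  have hcsq : (81 / 100 * a) ^ 2 ≤ c ^ 2 := pow_le_pow_left₀ hc0 hc1 2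
  have hcsq2 : c ^ 2 ≤ (17 / 20 * a) ^ 2 := pow_le_pow_left₀ (hc0.trans hc1) hc2 2
  have hsp : -s k = 1 ∨ -s k = -1 := by rcases hs k with h1 | h1 <;> omega
  have hsm : s (k - 1) = 1 ∨ s (k - 1) = -1 := hs (k - 1)
  have h75 : 0 ≤ 7 / 5 * a := by positivity
  constructor
  · rintro ⟨hne, hlt⟩
    have hd2 := pow_lt_pow_left₀ hlt hd0 two_ne_zero
    have hF0 : (0 : ℝ) ≤
        ((3 * (2 * (i - i') + (j - j') + (haggLabel s k - haggLabel s k')) ^ 2 +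
          (3 * (j - j') + (haggLabel s k - haggLabel s k')) ^ 2 : ℤ) : ℝ) := by positivity
    have haF := mul_nonneg ha2.le hF0
    -- at most one layer apart
    have hK3 : (k - k') ^ 2 < 2 ^ 2 := by
      have hK3' : (((k - k') ^ 2 : ℤ) : ℝ) < 3 := by
        by_contra hge
        push Not at hge
        have h1 : 3 * c ^ 2 ≤ (((k - k') ^ 2 : ℤ) : ℝ) * c ^ 2 :=
          mul_le_mul_of_nonneg_right hge (sq_nonneg c)
        nlinarith
      have : (k - k') ^ 2 < (3 : ℤ) := by exact_mod_cast hK3'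
      omega
    obtain ⟨hK1, hK1'⟩ := abs_lt_of_sq_lt_sq' hK3 (by norm_num)
    rcases (show k' = k + 1 ∨ k' = k ∨ k' = k - 1 by omega) with hk' | hk' | hk'
    · subst hk'
      rw [haggLabel_sub_haggLabel_succ] at h12 hF0
      refine Or.inr (Or.inl ⟨rfl, (mem_threeOffsets_iff hsp).2 ?_⟩)
      have e1 : (((k - (k + 1)) ^ 2 : ℤ) : ℝ) = 1 := by push_cast; ring
      rw [e1] at h12
      rcases adjLayer_eq_four_or_sixteen_le (P := i - i') (Q := j - j') hsp with h4 | h16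
      · exact h4
      · exfalso
        have h16' : (16 : ℝ) ≤ ((3 * (2 * (i - i') + (j - j') + -s k) ^ 2 +
            (3 * (j - j') + -s k) ^ 2 : ℤ) : ℝ) := by exact_mod_cast h16
        nlinarith
    · subst hk'
      rw [sub_self, cast_sub_self_sq] at h12
      refine Or.inl ⟨rfl, mem_sixOffsets_iff.2 ?_⟩
      by_cases hPQ : (i - i', j - j') = (0, 0)
      · exfalso
        simp only [Prod.mk.injEq, sub_eq_zero] at hPQ
        exact hne (by rw [hPQ.1, hPQ.2])
      · have hge := twelve_le_inLayer hPQ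
        have hlt24 :
            ((3 * (2 * (i - i') + (j - j') + 0) ^ 2 + (3 * (j - j') + 0) ^ 2 : ℤ) : ℝ) < 24 := by
          nlinarith
        have hlt24' : 3 * (2 * (i - i') + (j - j') + 0) ^ 2 + (3 * (j - j') + 0) ^ 2 < 24 := by
          exact_mod_cast hlt24
        have hm : 3 * (2 * (i - i') + (j - j')) ^ 2 + (3 * (j - j')) ^ 2 =
            12 * ((i - i') ^ 2 + (i - i') * (j - j') + (j - j') ^ 2) := by ring
        simp only [add_zero] at hlt24'
        rw [hm] at hge hlt24' ⊢
        omega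
    · subst hk'
      rw [haggLabel_sub_haggLabel_pred] at h12 hF0
      refine Or.inr (Or.inr ⟨rfl, (mem_threeOffsets_iff hsm).2 ?_⟩)
      have e1 : (((k - (k - 1)) ^ 2 : ℤ) : ℝ) = 1 := by push_cast; ring
      rw [e1] at h12
      rcases adjLayer_eq_four_or_sixteen_le (P := i - i') (Q := j - j') hsm with h4 | h16
      · exact h4
      · exfalso
        have h16' : (16 : ℝ) ≤ ((3 * (2 * (i - i') + (j - j') + s (k - 1)) ^ 2 +
            (3 * (j - j') + s (k - 1)) ^ 2 : ℤ) : ℝ) := by exact_mod_cast h16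
        nlinarith
  · intro hN
    -- `d² = a²` or `d² = a²/3 + c²`, so `0 < d < 7a/5`
    have hsq := sq_dist_of_offsets (a := a) (c := c) hs hN
    have hd2 : dist (barlowPos a c s k i j) (barlowPos a c s k' i' j') ^ 2 < (7 / 5 * a) ^ 2 := by
      rcases hsq with h1 | h1 <;> rw [h1] <;> nlinarith
    have hpos : 0 < dist (barlowPos a c s k i j) (barlowPos a c s k' i' j') ^ 2 := by
      rcases hsq with h1 | h1 <;> rw [h1] <;> nlinarith
    refine ⟨fun heq => ?_, lt_of_pow_lt_pow_left₀ 2 h75 hd2⟩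
    rw [heq, dist_self] at hpos
    norm_num at hpos

/-- **The two near distances.** A near point (one of the twelve offsets) is at distance exactly
`a` (in layer) or `√(a²/3 + c²)` (adjacent layers) from the centre.
[cite: HalesDSP2012, §1.3] -/
theorem dist_eq_or_of_near (hs : IsHaggSeq s) (ha : 0 < a) (hc1 : 81 / 100 * a ≤ c)
    (hc2 : c ≤ 17 / 20 * a) {k i j k' i' j' : ℤ}
    (hne : barlowPos a c s k' i' j' ≠ barlowPos a c s k i j)
    (hlt : dist (barlowPos a c s k' i' j') (barlowPos a c s k i j) < 7 / 5 * a) :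
    dist (barlowPos a c s k' i' j') (barlowPos a c s k i j) = a ∨
      dist (barlowPos a c s k' i' j') (barlowPos a c s k i j) = Real.sqrt (a ^ 2 / 3 + c ^ 2) := by
  have hN := (near_iff_offsets hs ha hc1 hc2 k i j k' i' j').1 ⟨hne, hlt⟩
  rw [dist_comm]
  rcases sq_dist_of_offsets (a := a) (c := c) hs hN with h1 | h1
  · exact Or.inl ((sq_eq_sq₀ dist_nonneg ha.le).1 h1)
  · right
    rw [← h1, Real.sqrt_sq dist_nonneg]

/-! ## The twelve near points as a set -/

/-- **The near set is the image of the twelve offsets** (window twin of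
`BarlowCoordination.touching_eq_union`). [cite: HalesDSP2012, §1.3] -/
theorem nearSet_eq_union (hs : IsHaggSeq s) (ha : 0 < a) (hc1 : 81 / 100 * a ≤ c)
    (hc2 : c ≤ 17 / 20 * a) (k i j : ℤ) :
    {z | z ∈ barlowStacking a c s ∧ (z ≠ barlowPos a c s k i j ∧
        dist z (barlowPos a c s k i j) < 7 / 5 * a)} =
      offsetPos a c s i j k '' ↑sixOffsets ∪
        (offsetPos a c s i j (k + 1) '' ↑(threeOffsets (-s k)) ∪
          offsetPos a c s i j (k - 1) '' ↑(threeOffsets (s (k - 1)))) := by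
  ext w
  simp only [Set.mem_setOf_eq, Set.mem_union, Set.mem_image, Finset.mem_coe]
  constructor
  · rintro ⟨⟨k', i', j', rfl⟩, hd⟩
    rcases (near_iff_offsets hs ha hc1 hc2 k i j k' i' j').1 hd with
      ⟨rfl, hm⟩ | ⟨rfl, hm⟩ | ⟨rfl, hm⟩
    · exact Or.inl ⟨(i - i', j - j'), hm, by simp [offsetPos]⟩
    · exact Or.inr (Or.inl ⟨(i - i', j - j'), hm, by simp [offsetPos]⟩)
    · exact Or.inr (Or.inr ⟨(i - i', j - j'), hm, by simp [offsetPos]⟩)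
  · rintro (⟨PQ, hm, rfl⟩ | ⟨PQ, hm, rfl⟩ | ⟨PQ, hm, rfl⟩) <;>
      refine ⟨barlowPos_mem _ _ _, (near_iff_offsets hs ha hc1 hc2 k i j _ _ _).2 ?_⟩
    · exact Or.inl ⟨rfl, by simpa using hm⟩
    · exact Or.inr (Or.inl ⟨rfl, by simpa using hm⟩)
    · exact Or.inr (Or.inr ⟨rfl, by simpa using hm⟩)

/-- **Twelve near points** (window twin of `BarlowCoordination.ncard_touching_barlowPos`).
[cite: HalesDSP2012, §1.3] -/
theorem ncard_nearSet (hs : IsHaggSeq s) (ha : 0 < a) (hc1 : 81 / 100 * a ≤ c)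
    (hc2 : c ≤ 17 / 20 * a) (k i j : ℤ) :
    {z | z ∈ barlowStacking a c s ∧ (z ≠ barlowPos a c s k i j ∧
        dist z (barlowPos a c s k i j) < 7 / 5 * a)}.ncard = 12 := by
  have hh0 : c ≠ 0 := by
    intro h0
    rw [h0] at hc1
    linarith
  rw [nearSet_eq_union hs ha hc1 hc2]
  have hinj := fun k' => offsetPos_injective (h := c) (s := s) ha i j k'
  have hlay : ∀ {k₁ k₂ : ℤ} (A B : Finset (ℤ × ℤ)), k₁ ≠ k₂ →
      Disjoint (offsetPos a c s i j k₁ '' ↑A) (offsetPos a c s i j k₂ '' ↑B) := by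
    intro k₁ k₂ A B hk
    refine Set.disjoint_left.2 ?_
    rintro _ ⟨PQ, _, rfl⟩ ⟨PQ', _, heq⟩
    exact hk (offsetPos_layer_eq hh0 heq.symm)
  have hfin : ∀ (k' : ℤ) (A : Finset (ℤ × ℤ)), (offsetPos a c s i j k' '' ↑A).Finite :=
    fun k' A => A.finite_toSet.image _
  rw [Set.ncard_union_eq ((hlay _ _ (by omega)).union_right (hlay _ _ (by omega))) (hfin _ _)
      ((hfin _ _).union (hfin _ _)),
    Set.ncard_union_eq (hlay _ _ (by omega)) (hfin _ _) (hfin _ _),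
    Set.ncard_image_of_injective _ (hinj _), Set.ncard_image_of_injective _ (hinj _),
    Set.ncard_image_of_injective _ (hinj _), Set.ncard_coe_finset, Set.ncard_coe_finset,
    Set.ncard_coe_finset, card_sixOffsets, card_threeOffsets, card_threeOffsets]

/-! ## The link in relative coordinates -/

/-- `relPos` is injective (different layers have different heights `c ≠ 0`, and
`offsetPos_injective` within a layer). [folklore] -/
theorem relPos_injective_window (ha : 0 < a) (hh0 : c ≠ 0) (k i j : ℤ) :
    Function.Injective (relPos a c s k i j) := by
  intro x y hxy
  have h1 : k + x.1 = k + y.1 := offsetPos_layer_eq hh0 hxy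
  have h1' : x.1 = y.1 := by omega
  unfold relPos at hxy
  rw [h1] at hxy
  have h2 : x.2 = y.2 := offsetPos_injective (h := c) (s := s) ha i j (k + y.1) hxy
  exact Prod.ext h1' h2

/-- **The near set in relative coordinates**: the near points of `barlowPos a c s k i j` are
exactly the `relPos` images of `linkOffsets (s (k−1)) (s k)` (window twin of
`BarlowRings.touching_iff_exists_linkOffsets`). [cite: HalesDSP2012, §1.3] -/
theorem near_iff_exists_linkOffsets (hs : IsHaggSeq s) (ha : 0 < a) (hc1 : 81 / 100 * a ≤ c)
    (hc2 : c ≤ 17 / 20 * a) (k i j : ℤ) (w : EuclideanSpace ℝ (Fin 3)) :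
    (w ∈ barlowStacking a c s ∧ (w ≠ barlowPos a c s k i j ∧
        dist w (barlowPos a c s k i j) < 7 / 5 * a)) ↔
      ∃ x ∈ linkOffsets (s (k - 1)) (s k), relPos a c s k i j x = w := by
  have hTu := Set.ext_iff.1 (nearSet_eq_union hs ha hc1 hc2 k i j) w
  rw [Set.mem_setOf_eq] at hTu
  rw [hTu]
  simp only [Set.mem_union, Set.mem_image, Finset.mem_coe, linkOffsets, Finset.mem_union,
    Finset.mem_image]
  constructor
  · rintro (⟨PQ, hPQ, rfl⟩ | ⟨PQ, hPQ, rfl⟩ | ⟨PQ, hPQ, rfl⟩)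
    · exact ⟨(0, PQ), Or.inl (Or.inl ⟨PQ, hPQ, rfl⟩), by simp [relPos]⟩
    · exact ⟨(1, PQ), Or.inl (Or.inr ⟨PQ, hPQ, rfl⟩), rfl⟩
    · exact ⟨(-1, PQ), Or.inr ⟨PQ, hPQ, rfl⟩, by simp [relPos, sub_eq_add_neg]⟩
  · rintro ⟨x, (⟨PQ, hPQ, rfl⟩ | ⟨PQ, hPQ, rfl⟩) | ⟨PQ, hPQ, rfl⟩, rfl⟩
    · exact Or.inl ⟨PQ, hPQ, by simp [relPos]⟩
    · exact Or.inr (Or.inl ⟨PQ, hPQ, rfl⟩)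
    · exact Or.inr (Or.inr ⟨PQ, hPQ, by simp [relPos, sub_eq_add_neg]⟩)

/-- **Nearness between two points of the shell is `linkAdj`** (for relative layers in
`{−1, 0, 1}`; window twin of `BarlowRings.dist_relPos_eq_iff_linkAdj`). [folklore] -/
theorem near_relPos_iff_linkAdj (hs : IsHaggSeq s) (ha : 0 < a) (hc1 : 81 / 100 * a ≤ c)
    (hc2 : c ≤ 17 / 20 * a) (k i j : ℤ) {x y : ℤ × ℤ × ℤ}
    (hx : x.1 = -1 ∨ x.1 = 0 ∨ x.1 = 1) (hy : y.1 = -1 ∨ y.1 = 0 ∨ y.1 = 1) :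
    (relPos a c s k i j y ≠ relPos a c s k i j x ∧
        dist (relPos a c s k i j y) (relPos a c s k i j x) < 7 / 5 * a) ↔
      linkAdj (s (k - 1)) (s k) x y := by
  unfold relPos offsetPos
  rw [near_iff_offsets hs ha hc1 hc2]
  have e1 : (i - x.2.1 - (i - y.2.1), j - x.2.2 - (j - y.2.2)) =
      (y.2.1 - x.2.1, y.2.2 - x.2.2) := by
    ext <;> simp only <;> ring
  rw [e1]
  refine or_congr (and_congr_left' (by omega)) (or_congr ?_ ?_)
  · -- next layer: only `x.1 ∈ {-1, 0}` can occur
    rcases hx with hx1 | hx1 | hx1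
    · have hl : letterAt (s (k - 1)) (s k) x.1 = s (k + x.1) := by
        rw [letterAt, if_neg (by omega), if_pos hx1, hx1]; ring_nf
      rw [hl]
      exact and_congr_left' (by omega)
    · have hl : letterAt (s (k - 1)) (s k) x.1 = s (k + x.1) := by
        rw [letterAt, if_pos hx1, hx1, add_zero]
      rw [hl]
      exact and_congr_left' (by omega)
    · constructor <;> rintro ⟨h1, -⟩ <;> omega
  · -- previous layer: only `x.1 ∈ {0, 1}` can occur
    rcases hx with hx1 | hx1 | hx1
    · constructor <;> rintro ⟨h1, -⟩ <;> omega
    · have hl : letterAt (s (k - 1)) (s k) (x.1 - 1) = s (k + x.1 - 1) := by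
        rw [letterAt, if_neg (by omega), if_pos (by omega), hx1, add_zero]
      rw [hl]
      exact and_congr_left' (by omega)
    · have hl : letterAt (s (k - 1)) (s k) (x.1 - 1) = s (k + x.1 - 1) := by
        rw [letterAt, if_pos (by omega), hx1]; ring_nf
      rw [hl]
      exact and_congr_left' (by omega)

/-- **Four common near points** (window twin of `BarlowRings.ncard_commonTouching_eq_four`): for a
near point `z` of `barlowPos a c s k i j`, exactly four points of the stacking are near both.
[cite: HalesDSP2012, §1.3] -/
theorem ncard_commonNear (hs : IsHaggSeq s) (ha : 0 < a) (hc1 : 81 / 100 * a ≤ c)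
    (hc2 : c ≤ 17 / 20 * a) (k i j : ℤ) {z : EuclideanSpace ℝ (Fin 3)}
    (hz : z ∈ barlowStacking a c s) (hne : z ≠ barlowPos a c s k i j)
    (hlt : dist z (barlowPos a c s k i j) < 7 / 5 * a) :
    {w | w ∈ barlowStacking a c s ∧ (w ≠ barlowPos a c s k i j ∧ w ≠ z ∧
        dist w (barlowPos a c s k i j) < 7 / 5 * a ∧ dist w z < 7 / 5 * a)}.ncard = 4 := by
  have hh0 : c ≠ 0 := by
    intro h0
    rw [h0] at hc1
    linarith
  have hT := near_iff_exists_linkOffsets hs ha hc1 hc2 k i j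
  obtain ⟨x₁, hx₁, rfl⟩ := (hT z).1 ⟨hz, hne, hlt⟩
  have hσm : s (k - 1) ∈ ({1, -1} : Finset ℤ) := by
    rcases hs (k - 1) with h1 | h1 <;> simp [h1]
  have hσp : s k ∈ ({1, -1} : Finset ℤ) := by
    rcases hs k with h1 | h1 <;> simp [h1]
  have hset : {w | w ∈ barlowStacking a c s ∧ (w ≠ barlowPos a c s k i j ∧
      w ≠ relPos a c s k i j x₁ ∧ dist w (barlowPos a c s k i j) < 7 / 5 * a ∧
        dist w (relPos a c s k i j x₁) < 7 / 5 * a)} =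
        relPos a c s k i j ''
          ↑((linkOffsets (s (k - 1)) (s k)).filter (linkAdj (s (k - 1)) (s k) x₁)) := by
    ext w
    simp only [Set.mem_setOf_eq, Set.mem_image, Finset.coe_filter]
    constructor
    · rintro ⟨hw, hw0, hwz, hd0, hdz⟩
      obtain ⟨x₂, hx₂, rfl⟩ := (hT w).1 ⟨hw, hw0, hd0⟩
      exact ⟨x₂, ⟨hx₂, (near_relPos_iff_linkAdj hs ha hc1 hc2 k i j
        (fst_mem_of_mem_linkOffsets hx₁) (fst_mem_of_mem_linkOffsets hx₂)).1 ⟨hwz, hdz⟩⟩,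
        rfl⟩
    · rintro ⟨x₂, ⟨hx₂, hadj⟩, rfl⟩
      obtain ⟨hw, hw0, hd0⟩ := (hT _).2 ⟨x₂, hx₂, rfl⟩
      obtain ⟨hwz, hdz⟩ := (near_relPos_iff_linkAdj hs ha hc1 hc2 k i j
        (fst_mem_of_mem_linkOffsets hx₁) (fst_mem_of_mem_linkOffsets hx₂)).2 hadj
      exact ⟨hw, hw0, hwz, hd0, hdz⟩
  rw [hset, Set.ncard_image_of_injective _ (relPos_injective_window ha hh0 k i j),
    Set.ncard_coe_finset]
  exact card_filter_linkAdj _ hσm _ hσp x₁ hx₁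

end Window

/-- **First shell and link on the spacing window.** For `0 < a`, `0.81a ≤ c ≤ 0.85a` and a Hägg sequence `s`, near every point `z₀` of `barlowStacking a c s`: every other point closer than `7a/5` is at distance exactly `a` or `√(a²/3 + c²)`; there are exactly twelve of them; and each of the twelve has exactly four common near points with `z₀` (Hales, *Dense Sphere Packings* §1.3, cubocta/anticubocta links). [cite: HalesDSP2012, §1.3] -/
theorem stub_barlowWindowLink :
    ∀ (a c : ℝ) (s : ℤ → ℤ), 0 < a → 81 / 100 * a ≤ c → c ≤ 17 / 20 * a → IsHaggSeq s →
      ∀ z₀ ∈ barlowStacking a c s,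
        (∀ z ∈ barlowStacking a c s, z ≠ z₀ → dist z z₀ < 7 / 5 * a →
            dist z z₀ = a ∨ dist z z₀ = Real.sqrt (a ^ 2 / 3 + c ^ 2)) ∧
        {z ∈ barlowStacking a c s | z ≠ z₀ ∧ dist z z₀ < 7 / 5 * a}.ncard = 12 ∧
        (∀ z ∈ barlowStacking a c s, z ≠ z₀ → dist z z₀ < 7 / 5 * a →
            {w ∈ barlowStacking a c s | w ≠ z₀ ∧ w ≠ z ∧ dist w z₀ < 7 / 5 * a ∧
                dist w z < 7 / 5 * a}.ncard = 4) := by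
  intro a c s ha hc1 hc2 hs z₀ hz₀
  obtain ⟨k, i, j, rfl⟩ := hz₀
  refine ⟨?_, ncard_nearSet hs ha hc1 hc2 k i j, fun z hz hne hlt =>
    ncard_commonNear hs ha hc1 hc2 k i j hz hne hlt⟩
  rintro z ⟨k', i', j', rfl⟩ hne hlt
  exact dist_eq_or_of_near hs ha hc1 hc2 hne hlt

end Summit.AtomisticToContinuum.Crystallization.Theorems.PricedLinkCensusTruncatedCensusGap

end
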